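import Literature.AlgebraicGeometry.CossartPiltant200819.Prop48FundamentalLocus2008
import Literature.AlgebraicGeometry.Resolution.EmbeddedCurvePointBlowups
import Literature.AlgebraicGeometry.Resolution.PointCentrePermissible
import Literature.AlgebraicGeometry.Resolution.RegularCentreBlowupSeqExtensionIso
import Literature.AlgebraicGeometry.Resolution.QuasiExcellentClosedSubschemes
import Literature.AlgebraicGeometry.Resolution.QuasiExcellentBlowup
import Literature.AlgebraicGeometry.Resolution.FibreComponentsBaseChange
import Literature.AlgebraicGeometry.Resolution.AlterationsNormalFormStrictTransform
import Literature.AlgebraicGeometry.Resolution.MacaulayficationProjectiveReduction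
import Literature.AlgebraicGeometry.Resolution.NormalCrossingsLocal
import Literature.AlgebraicGeometry.Resolution.PointBlowupHsFunMono
import HarnessLib

/-!
# Cossart–Piltant 2008, Prop. 4.8: the printed proof (devices 1-, 2-), regular centres on `Z`

Companion of `Prop48FundamentalLocus2008.lean`, which types [CP-I] Prop. 4.8 VERBATIM as the
named statement `EliminationOfRegularFundamentalPoints` and proves it (from the principalization
theorem [CP-I] Prop. 4.2 = [CP-II] Prop. 4.4, the named fact `CossartPiltant2019Principalization`)
for REGULAR `Z`, and for arbitrary `Z` only in the form of Piltant's Axiom 4 — with the recorded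
DEVIATION that the extension of the Cossart–Piltant sequence from `Z_reg` to `Z` used there
(`IsRegularCentreBlowupSeq.exists_extension_full`) blows up the reduced closures `Ȳ(j)` of the
centres, which may be singular off `Z_reg`.  This file runs the printed proof instead and closes
that deviation: `eliminationOfRegularFundamentalPoints_of_principalization :
CossartPiltant2019Principalization → EliminationOfRegularFundamentalPoints`.

PRINTED TEXT (HAL p. 15, lines 24–37, the proof of Prop. 4.8):

> "Proof. Let `Z̃` be the closure of the graph of the birational map `T`. Then `Z̃` is
> projective, i.e. the blowing up of a certain ideal sheaf `I ⊂ O_Y`. We apply proposition 4.2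
> to the quasiprojective variety `U := Z_reg` and the ideal sheaf `I|_U`. Each blowing up center
> `Y(j) ⊂ U(j)` is either a closed point or a regular curve. For each `j`, `0 ≤ j ≤ n − 1`, we
> define inductively a projective variety `Z(j)` containing `U(j)` as a dense open subset as
> follows, with `Z(0) := Z` to begin with:
> 1- if `Y(j)` is a closed point, let `Z(j + 1)` be the blowing up of `Z(j)` along `Y(j)`;
> 2- if `Y(j)` is a regular curve, let `Ȳ(j)` be its Zariski closure in `Z(j)`. Let
> `Z(j + 1) → Z(j)` be the minimal composition of point blowing ups making the strict transform
> `Ȳ(j)′` of `Ȳ(j)` regular followed by the blowing up along `Ȳ(j)′`.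
> Let `q : Z′ := Z(n) → Z` be the obtained map. By the universal property of blowing up, the
> birational map `q ∘ T` is defined on `q⁻¹(F ∩ Z_reg)` and this concludes the proof."

DICTIONARY (declarations of `Literature/AlgebraicGeometry/Resolution` and of the companion file):
* "we apply proposition 4.2 to `U := Z_reg` and `I|_U`": as in the companion, Prop. 4.2 is the
  named fact `CossartPiltant2019Principalization` read on the regular locus
  (`ProjModel.regPrincipalization_of_principalization`), applied to the base ideal `J` of the
  coordinate vector of `T` restricted to `U` (`RationalMapBaseIdeal.lean`; the graph closure `Z̃`
  is the blowing up of that base ideal, Hartshorne II 7.17.3, and definedness of `q ∘ T` at a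
  point is local principality of `J𝒪`, `isDefinedAt_of_isLocallyPrincipalAt_comap`); the
  sequence `U = U(0) ← U(1) ← ⋯ ← U(n)` with centres `Y(j) ⊆ F(J𝒪_{U(j)})` regular integral is
  `IsRegularCentreBlowupSeq` (`Principalization.lean`).
* "`Z(j)` a projective variety containing `U(j)` as a dense open subset" = an integral scheme
  `X'` with an open immersion `j' : U(j) ↪ X'` cartesian over `U ↪ Z` (`IsPullback j' σ ρ U.ι`),
  `ρ : X' → Z` proper birational and projective over `k` whenever `Z` is
  (`Motives.IsProjectiveOver`); density is automatic (`X'` irreducible, `U(j) ≠ ∅`).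
* "`Ȳ(j)`, the Zariski closure of `Y(j)` in `Z(j)`" (reduced) = the reduced closed subscheme
  `V(𝓘(W)) ↪ X'` on `W := closure (j' Y(j))` (`closureImage`, `vanishingIdeal`, `subschemeι`);
  it is an integral curve or a closed point: a point of `F(J𝒪)` on the regular `U(j)` has
  codimension `≥ 2` (`one_lt_coheight_of_mem_nonPrincipalLocus`, [CP-I] proof of Prop. 4.2) and
  `dim Z(j) ≤ 3`, so `dim W ≤ 1` (`height_le_one_of_one_lt_coheight`).  Device 1- is the case
  `dim W = 0`, in which the composition of point blowing ups below is empty.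
* "the minimal composition of point blowing ups making the strict transform `Ȳ(j)′` of `Ȳ(j)`
  regular" = SOME composition of blowing ups of `Z(j)` at (reduced) closed points lying over the
  singular points of `Ȳ(j)` after which the strict transform is regular:
  `exists_embeddedResolution_of_curve` (`EmbeddedCurvePointBlowups.lean`, Liu, Algebraic
  Geometry and Arithmetic Curves, §9.2.4 Lemma 2.32, for integral Noetherian quasi-excellent
  schemes of dimension `≤ 1`), predicate `IsPointBlowupComposition T π` with
  `T = Sing Ȳ(j) ⊆ Z(j) ∖ U(j)` (`Ȳ(j)` is regular over `U(j)`, where it is `Y(j)`: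
  `isRegularLocalRing_stalk_subscheme_closureImage`).  MINIMALITY is not formalised (it plays
  no role in the statement of Prop. 4.8); the strict transform `Ȳ(j)′` is the scheme-theoretic
  closure `C' ↪ X₁` of the generic point, which is regular hence reduced, so the centre
  "`Ȳ(j)′`" is the reduced closed subscheme on `range (C' ↪ X₁)`
  (`isRegular_subscheme_vanishingIdeal_range`).
* "followed by the blowing up along `Ȳ(j)′`" = `blowup (vanishingIdeal ⟨range i', _⟩)`
  (`BlowupsExistence.lean`); that over `U(j)` this is the blowing up `U(j+1) → U(j)` along
  `Y(j)` is flat base change of blowing ups along the open immersion (Görtz–Wedhorn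
  Prop. 13.91 (2), `IsBlowup.isPullback_of_isOpenImmersion`), using `Ȳ(j)′ ∩ U(j) = Y(j)`
  (the point blowing ups are isomorphisms over `U(j)`, `IsPointBlowupComposition.
  exists_isPullback_of_disjoint`, and `Ȳ(j)′ → Ȳ(j)` is surjective and injective over `U(j)`).
* "a composition of blowing ups with regular centers" = `IsRegularCentreBlowupComposition` of
  the companion file; point blowing ups are such (`of_isPointBlowupComposition`: a reduced closed
  point of a locally Noetherian scheme is an integral regular centre).

CONTENTS (all PROVED, `0` sorries):
* supplements on `IsPointBlowupComposition` (dimension, projectivity over a field, pull-back to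
  an isomorphism along an open immersion missing `T`) and on reduced closures over an open
  (`isRegularLocalRing_stalk_subscheme_closureImage`);
* `IsRegularCentreBlowupComposition.comp`, `.of_isPointBlowupComposition`;
* `exists_extension_regularCentre` — the inductive construction `Z(0) ← Z(1) ← ⋯ ← Z(n)` of the
  printed proof: a Cossart–Piltant sequence on a regular integral open `S ↪ X` of an integral
  Noetherian quasi-excellent `X` of dimension `≤ 3` extends to a composition of blowing ups of
  `X` with REGULAR centres, cartesian over `S`, proper birational, projective over `k` when `X`
  is, an isomorphism off the closure of the non-locally-principal locus, `dim ≤ 3` preserved;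
* `exists_hom_regularCentre_forall_not_mem_fundamentalLocus_of_regPrincipalization` — Prop 4.8
  with global regular centres plus Piltant's Axiom 4 (ii)–(iii) (`q⁻¹(Z_reg) ⊆ Reg Z'`, `q` an
  isomorphism off the closure of `F ∩ Z_reg`), from principalization on `Z_reg`, `dim Z ≤ 3`;
* `eliminationOfRegularFundamentalPoints_of_principalization` — **Prop 4.8 VERBATIM from
  `CossartPiltant2019Principalization`** — and `…_of_trdeg`,
  `refinedPatching_of_props47And48_of_principalization` (the printed reduction of Prop 4.9 now
  needs only [12] and Prop. 4.2).

RESIDUAL DEVIATIONS, recorded not hidden: (a) Prop. 4.2 enters as the named fact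
`CossartPiltant2019Principalization` (as everywhere in this directory); (b) "minimal" in device
2- is replaced by "some" (see DICTIONARY); (c) quasi-excellence of `Z` comes from
`Stacks07QW_field_holds` (fields are excellent, a theorem of the tree) and finite type.

CAVEAT.  Kernel-checked rendering of one printed proof against the tree's definitions, modulo
the named principalization fact.  AI-written; weaker than expert review.  NOT summit progress.
-/

noncomputable section

open CategoryTheory CategoryTheory.Limits AlgebraicGeometry TopologicalSpace IsLocalRing

universe u

/-! ## Supplements on compositions of point blowing ups -/


namespace Literature.AlgebraicGeometry.Resolution

open Scheme.IdealSheafData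

namespace IsPointBlowupComposition

variable {X : Scheme.{u}} {T : Set X}

/-- Compositions of point blowing ups do not raise the dimension. [folklore] -/
theorem topologicalKrullDim_le [IsIntegral X] [IsLocallyNoetherian X] {n : ℕ} :
    ∀ {X' : Scheme.{u}} {π : X' ⟶ X}, IsPointBlowupComposition T π →
      topologicalKrullDim X ≤ n → topologicalKrullDim X' ≤ n := by
  intro X' π h
  induction h with
  | nil => exact id
  | cons τ σ x' hx' hσ hne hT hτ ih =>
    intro hd
    haveI := hσ.isIntegral inferInstance
    haveI := hσ.isLocallyNoetherian
    exact hτ.topologicalKrullDim_le (ih hd)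

/-- Compositions of point blowing ups of a projective `k`-scheme are projective over `k`.
[cite: Hartshorne1977, II Prop. 7.16 (c)] -/
theorem isProjectiveOver {k : Type u} [Field k] :
    ∀ {X' : Scheme.{u}} {π : X' ⟶ X}, IsPointBlowupComposition T π →
      ∀ f : X ⟶ Spec (.of k), Motives.IsProjectiveOver (Over.mk f) →
        Motives.IsProjectiveOver (Over.mk (π ≫ f)) := by
  intro X' π h
  induction h with
  | nil => intro f hf; rwa [Category.id_comp]
  | cons τ σ x' hx' hσ hne hT hτ ih =>
    intro f hf
    rw [Category.assoc]
    exact hτ.isProjectiveOver (σ ≫ f) (ih f hf)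

/-- **A composition of point blowing ups over `T` pulls back to an isomorphism along every open
immersion whose image misses `T`**: there is an open immersion `j₁ : S ↪ X'` with `j₁ ≫ π = j`
and a cartesian square `(j₁, 𝟙, π, j)`. [cite: GortzWedhorn2020, Prop. 13.91 (2)] -/
theorem exists_isPullback_of_disjoint :
    ∀ {X' : Scheme.{u}} {π : X' ⟶ X}, IsPointBlowupComposition T π →
      ∀ {S : Scheme.{u}} (j : S ⟶ X) [IsOpenImmersion j], Disjoint (Set.range j) T →
        ∃ j₁ : S ⟶ X', IsOpenImmersion j₁ ∧ j₁ ≫ π = j ∧ IsPullback j₁ (𝟙 S) π j := by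
  intro X' π h
  induction h with
  | nil =>
    intro S j _ _
    exact ⟨j, inferInstance, Category.comp_id _, IsPullback.of_vert_isIso ⟨by simp⟩⟩
  | @cons X'' X' τ σ x' hx' hσ hne hT hτ ih =>
    intro S j _ hjT
    obtain ⟨j₁, hj₁, hj₁σ, hpb⟩ := ih j hjT
    haveI := hj₁
    -- the centre misses `j₁(S)`, so its ideal pulls back to the unit ideal
    have hx'r : x' ∉ Set.range j₁ := by
      rintro ⟨s, hs⟩
      refine Set.disjoint_left.mp hjT ⟨s, rfl⟩ ?_
      rw [← hj₁σ, Scheme.Hom.comp_apply, hs]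
      exact hT
    have htop : (vanishingIdeal (⟨{x'}, hx'⟩ : Closeds X')).comap j₁ = ⊤ := by
      rw [← support_eq_bot_iff, support_comap]
      ext s
      simp only [Closeds.coe_preimage, Set.mem_preimage, SetLike.mem_coe, Closeds.coe_bot,
        Set.mem_empty_iff_false, iff_false]
      intro hs
      rw [← SetLike.mem_coe, coe_support_vanishingIdeal] at hs
      exact hx'r ⟨s, hs⟩
    have hid : IsBlowup (𝟙 S) ((vanishingIdeal (⟨{x'}, hx'⟩ : Closeds X')).comap j₁) := by
      rw [htop]; exact isBlowup_id_top S
    let j₂ : S ⟶ X'' := hτ.lift j₁ (by rw [htop]; exact isEffectiveCartier_top)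
    have hj₂ : j₂ ≫ τ = j₁ := hτ.lift_comp _ _
    have hsq : IsPullback j₂ (𝟙 S) τ j₁ :=
      hτ.isPullback_of_isOpenImmersion j₁ hid (by rw [hj₂, Category.id_comp])
    haveI : IsOpenImmersion j₂ := MorphismProperty.of_isPullback hsq.flip inferInstance
    refine ⟨j₂, inferInstance, by rw [← Category.assoc, hj₂, hj₁σ], ?_⟩
    simpa using hsq.paste_vert hpb

end IsPointBlowupComposition

/-- **Points of the reduced closure `closure (j Y)` over the open `j(S)` are regular when the
reduced centre `Y` is**: the quotient stalk `𝒪_{X,j s}/𝓘_{closure (j Y), j s}` is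
`𝒪_{S,s}/𝓘_{Y,s}` along `j^*_s`. [folklore] -/
theorem isRegularLocalRing_stalk_subscheme_closureImage {S X : Scheme.{u}} (j : S ⟶ X)
    [IsOpenImmersion j] (Y : Closeds S) (hYreg : Scheme.IsRegular (vanishingIdeal Y).subscheme)
    (w : (vanishingIdeal (closureImage j (Y : Set S))).subscheme)
    (hw : (vanishingIdeal (closureImage j (Y : Set S))).subschemeι w ∈ Set.range j) :
    IsRegularLocalRing
      ((vanishingIdeal (closureImage j (Y : Set S))).subscheme.presheaf.stalk w) := by
  obtain ⟨s, hs⟩ := hw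
  rw [isRegularLocalRing_stalk_subscheme_iff, ← hs]
  -- `s ∈ Y`
  have hsY : s ∈ Y := by
    have h1 : (vanishingIdeal (closureImage j (Y : Set S))).subschemeι w ∈
        (closureImage j (Y : Set S) : Set X) :=
      mem_of_subscheme_vanishingIdeal _ w
    rw [← hs] at h1
    have h2 : s ∈ ((closureImage j (Y : Set S)).preimage j.continuous : Set S) := h1
    rwa [preimage_closureImage_eq] at h2
  -- the point of `V(𝓘_Y)` over `s` has the regular local ring `𝒪_{S,s}/𝓘_{Y,s}`
  obtain ⟨y, hy⟩ : s ∈ Set.range (vanishingIdeal Y).subschemeι := by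
    rw [range_subschemeι_vanishingIdeal]; exact hsY
  have hreg : IsRegularLocalRing (S.presheaf.stalk s ⧸ stalkIdeal (vanishingIdeal Y) s) := by
    have := (isRegularLocalRing_stalk_subscheme_iff (vanishingIdeal Y) y).mp (hYreg y)
    rwa [show (vanishingIdeal Y).subschemeι.base y = s from hy] at this
  -- transport along `j^*_s : 𝒪_{X,j s} ≅ 𝒪_{S,s}`
  have hC : (vanishingIdeal (closureImage j (Y : Set S))).comap j = vanishingIdeal Y :=
    comap_vanishingIdeal_closureImage j Y
  let e : X.presheaf.stalk (j s) ≃+* S.presheaf.stalk s :=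
    (asIso (j.stalkMap s)).commRingCatIsoToRingEquiv
  have hmap : (stalkIdeal (vanishingIdeal (closureImage j (Y : Set S))) (j s)).map
      (e : X.presheaf.stalk (j s) →+* S.presheaf.stalk s) = stalkIdeal (vanishingIdeal Y) s := by
    rw [← hC, stalkIdeal_comap_of_isOpenImmersion]; rfl
  exact IsRegularLocalRing.of_ringEquiv (Ideal.quotientEquiv _ _ e hmap.symm).symm

end Literature.AlgebraicGeometry.Resolution

namespace Literature.AlgebraicGeometry.CossartPiltant200819.CP2008

open Literature.AlgebraicGeometry.Resolution Literature.AlgebraicGeometry.Motives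
open Scheme.IdealSheafData

namespace IsRegularCentreBlowupComposition

/-- Concatenation of compositions of blowing ups with regular centres. [folklore] -/
theorem comp : ∀ {X'' X' : Scheme.{u}} {π : X'' ⟶ X'}, IsRegularCentreBlowupComposition π →
    ∀ {X : Scheme.{u}} {ρ : X' ⟶ X}, IsRegularCentreBlowupComposition ρ →
      IsRegularCentreBlowupComposition (π ≫ ρ) := by
  intro X'' X' π h
  induction h with
  | nil Z => intro X ρ hρ; simpa using hρ
  | cons τ q Y hq hY hint hreg hτ ih =>
    intro X ρ hρ
    rw [Category.assoc]
    exact cons τ (q ≫ ρ) Y (ih hρ) hY hint hreg hτ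

/-- **A composition of point blowing ups of a locally Noetherian scheme is a composition of
blowing ups with regular centres**: the reduced closed point is an integral regular closed
subscheme (`isIntegral/isRegular_subscheme_vanishingIdeal_singleton`).
[cite: CossartPiltant2008, proof of Prop. 4.8 (device 1-)] -/
theorem of_isPointBlowupComposition {X : Scheme.{u}} [IsLocallyNoetherian X] {T : Set X} :
    ∀ {X' : Scheme.{u}} {π : X' ⟶ X}, IsPointBlowupComposition T π →
      IsRegularCentreBlowupComposition π := by
  intro X' π h
  induction h with
  | nil => exact nil X
  | cons τ σ x' hx' hσ hne hT hτ ih =>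
    haveI := hσ.isLocallyNoetherian
    exact cons τ σ ⟨{x'}, hx'⟩ ih hne (isIntegral_subscheme_vanishingIdeal_singleton hx')
      (isRegular_subscheme_vanishingIdeal_singleton hx') hτ

end IsRegularCentreBlowupComposition

/-- Height bookkeeping in dimension `≤ 3`: a point of codimension `> 1` has height `≤ 1`.
[cite: CossartPiltant2008, proof of Prop. 4.2] -/
theorem height_le_one_of_one_lt_coheight {X : Scheme.{u}} (hdim : topologicalKrullDim X ≤ 3)
    {x : X} (h1 : (1 : ℕ∞) < Order.coheight x) : Order.height x ≤ 1 := by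
  have h2 : Order.height x + Order.coheight x ≤ 3 := by
    have := (coe_height_add_coheight_le_topologicalKrullDim x).trans hdim
    rwa [← WithBot.coe_ofNat, WithBot.coe_le_coe] at this
  have hc : Order.coheight x ≠ ⊤ := by
    intro h
    rw [h, add_top, top_le_iff] at h2
    exact ENat.coe_ne_top 3 h2
  have hh : Order.height x ≠ ⊤ := by
    intro h
    rw [h, top_add, top_le_iff] at h2
    exact ENat.coe_ne_top 3 h2
  obtain ⟨c, hc'⟩ := ENat.ne_top_iff_exists.mp hc
  obtain ⟨a, ha'⟩ := ENat.ne_top_iff_exists.mp hh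
  rw [← hc', ← ha'] at h2
  rw [← hc'] at h1
  rw [← ha']
  have h1' : 1 < c := by exact_mod_cast h1
  have h2' : a + c ≤ 3 := by exact_mod_cast h2
  exact_mod_cast (show a ≤ 1 by omega)

/-- **[CP-I] Prop. 4.8, proof, devices 1- and 2-: extending a Cossart–Piltant sequence from a
regular open `S ↪ X` to `X` by a composition of blowing ups with REGULAR centres.**  Let
`σ : S' → S` be a Cossart–Piltant sequence for `J ≠ 0` on the regular integral `S`
(`IsRegularCentreBlowupSeq`), and `j : S ↪ X` an open immersion into an integral Noetherian
quasi-excellent `X` of dimension `≤ 3`.  Then there are `ρ : X' → X`, a composition of blowing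
ups with regular centres (`IsRegularCentreBlowupComposition`), and an open immersion
`j' : S' ↪ X'` with `S' = X' ×_X S`; `ρ` is proper and birational, `X'` integral of dimension
`≤ 3`, projective over any field over which `X` is, and `ρ` is an isomorphism over
`X ∖ closure (j F)`, `F` the non-locally-principal locus of `J`.  Inductive step, as printed
(HAL p. 15): for a centre `Y(j) ⊆ U(j) = S'`, take its reduced Zariski closure `Ȳ(j) ⊆ Z(j) = X'`
— an integral curve or a closed point (a point of `F` has codimension `≥ 2`,
`one_lt_coheight_of_mem_nonPrincipalLocus`), regular over `U(j)`
(`isRegularLocalRing_stalk_subscheme_closureImage`); device 2-: blow up closed points of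
`Z(j)` off `U(j)` until the strict transform `Ȳ(j)′` is regular
(`exists_embeddedResolution_of_curve`, Liu Lemma 9.2.32) — these are regular centres
(`of_isPointBlowupComposition`), isomorphisms over `U(j)` (`exists_isPullback_of_disjoint`)
and over `X ∖ closure (j F)`; then blow up along `Ȳ(j)′`, whose restriction over `U(j)` is the
blowing up along `Y(j)` (GW Prop. 13.91 (2), `IsBlowup.isPullback_of_isOpenImmersion`).
[cite: CossartPiltant2008, Prop 4.8 (HAL p. 15 L24–37)] [cite: Liu2002, §9.2.4 Lemma 2.32]
[cite: Piltant2013, Prop. 5.1 (proof, Step 2)] -/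
theorem exists_extension_regularCentre :
    ∀ {S' S : Scheme.{u}} {σ : S' ⟶ S} {J : S.IdealSheafData}, IsRegularCentreBlowupSeq σ J →
      IsIntegral S → IsLocallyNoetherian S → J ≠ ⊥ → Scheme.IsRegular S →
      ∀ {X : Scheme.{u}} [IsIntegral X] [IsNoetherian X], Scheme.IsQuasiExcellent X →
        topologicalKrullDim X ≤ 3 → ∀ (j : S ⟶ X) [IsOpenImmersion j],
        ∃ (X' : Scheme.{u}) (ρ : X' ⟶ X) (j' : S' ⟶ X'), IsOpenImmersion j' ∧
          IsPullback j' σ ρ j ∧ IsProper ρ ∧ IsIntegral X' ∧ IsBirational ρ ∧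
          (∀ (k : Type u) [Field k] (f : X ⟶ Spec (.of k)),
            Motives.IsProjectiveOver (Over.mk f) → Motives.IsProjectiveOver (Over.mk (ρ ≫ f))) ∧
          IsIso (ρ ∣_ principalOpen j J) ∧ topologicalKrullDim X' ≤ 3 ∧
          IsRegularCentreBlowupComposition ρ := by
  intro S' S σ J h
  induction h with
  | nil J =>
    intro _ _ _ _ X _ _ _ hdim j _
    exact ⟨X, 𝟙 X, j, inferInstance, IsPullback.of_vert_isIso ⟨by simp⟩, inferInstance,
      inferInstance, isBirational_id X, fun k _ f hf => by rwa [Category.id_comp], inferInstance,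
      hdim, .nil X⟩
  | @cons S'' S' S τ σ J Y hσ hYint hYreg hY hτ ih =>
    intro hint hN hJ hreg X _ _ hqe hdim j _
    obtain ⟨X', ρ, j', hj', hpb, hprop, hint', hbir, hproj, hiso, hdim', hcomp⟩ :=
      ih hint hN hJ hreg hqe hdim j
    haveI := hj'
    haveI := hint'
    haveI := hprop
    haveI := hiso
    haveI : IsLocallyNoetherian X' := LocallyOfFiniteType.isLocallyNoetherian ρ
    haveI : CompactSpace X' := QuasiCompact.compactSpace_of_compactSpace ρ
    haveI : IsNoetherian X' := {}
    have hqe' : Scheme.IsQuasiExcellent X' := hqe.of_locallyOfFiniteType ρ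
    obtain ⟨hintS', hNS', hJ'⟩ := hσ.isIntegral_and_comap_ne_bot hint hN hJ
    haveI := hintS'
    haveI := hNS'
    have hregS' : Scheme.IsRegular S' := hσ.isRegular hreg
    -- the centre is a proper closed subset of `S'`
    have hYne : (Y : Set S') ≠ Set.univ := by
      intro hYu
      apply nonPrincipalLocus_ne_top hJ'
      rw [eq_top_iff]
      intro y _
      exact hY y (by rw [hYu]; trivial)
    /- the reduced Zariski closure `W = Ȳ` of `j'(Y)` in `X'`, an integral Noetherian
      quasi-excellent closed subscheme `ι : V(C) ↪ X'` -/
    let W : Closeds X' := closureImage j' (Y : Set S')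
    let C : X'.IdealSheafData := vanishingIdeal W
    have hC : C.comap j' = vanishingIdeal Y := comap_vanishingIdeal_closureImage j' Y
    let ι : C.subscheme ⟶ X' := C.subschemeι
    have hYirr : IsIrreducible (Y : Set S') := by
      rw [← range_subschemeι_vanishingIdeal Y, ← Set.image_univ]
      exact (IrreducibleSpace.isIrreducible_univ _).image _
        (vanishingIdeal Y).subschemeι.continuous.continuousOn
    have hWirr : IsIrreducible (W : Set X') := by
      change IsIrreducible (closure (j' '' (Y : Set S')))
      exact (hYirr.image _ j'.continuous.continuousOn).closure
    haveI hWint : IsIntegral C.subscheme := isIntegral_subscheme_vanishingIdeal W hWirr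
    haveI : IsLocallyNoetherian C.subscheme := LocallyOfFiniteType.isLocallyNoetherian ι
    haveI : CompactSpace C.subscheme := QuasiCompact.compactSpace_of_compactSpace ι
    haveI : IsNoetherian C.subscheme := {}
    have hqeW : Scheme.IsQuasiExcellent C.subscheme := hqe'.of_isClosedImmersion ι
    /- `W` has dimension `≤ 1`: its generic point `j'(y₀)`, `y₀` the generic point of `Y`, has
      codimension `> 1` (`y₀ ∈ F(J𝒪_{S'})` on the regular `S'`) in `X'` of dimension `≤ 3` -/
    have hdimW : topologicalKrullDim C.subscheme ≤ 1 := by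
      rw [topologicalKrullDim_subscheme_vanishingIdeal]
      let y₀ : S' := hYirr.genericPoint
      have hy₀ : IsGenericPoint y₀ (Y : Set S') := hYirr.isGenericPoint_genericPoint Y.isClosed
      have hgen : IsGenericPoint (j' y₀) (W : Set X') := hy₀.image j'.continuous
      rw [← hgen.def, topologicalKrullDim_closure_singleton_eq_height]
      have hco : (1 : ℕ∞) < Order.coheight (j' y₀) := by
        rw [show (j' y₀) = j'.base y₀ from rfl, coheight_eq_of_isOpenImmersion]
        exact one_lt_coheight_of_mem_nonPrincipalLocus hregS' (hY y₀ hy₀.mem)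
      exact_mod_cast height_le_one_of_one_lt_coheight hdim' hco
    /- `W` is regular over `U(j) = j'(S')`: the centres of device 2- miss `j'(S')` -/
    have hT : Disjoint (Set.range j') (ι '' (Scheme.regularLocus C.subscheme)ᶜ) := by
      refine Set.disjoint_left.mpr ?_
      rintro _ ⟨s, rfl⟩ ⟨w, hw, hws⟩
      exact hw (isRegularLocalRing_stalk_subscheme_closureImage j' Y hYreg w ⟨s, hws.symm⟩)
    /- device 2-: point blowing ups `π : X₁ → X'` making the strict transform `C'` of `W`
      regular, `i' : C' ↪ X₁` -/
    obtain ⟨X₁, C', π, i', ρW, hπ, hi', hsqW, hintC', hregC', hpropW, hbirW⟩ :=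
      exists_embeddedResolution_of_curve ι hqeW hdimW
    haveI := hi'
    haveI := hintC'
    haveI := hpropW
    haveI : IsIntegral X₁ := hπ.isIntegral inferInstance
    haveI : IsLocallyNoetherian X₁ := hπ.isLocallyNoetherian
    haveI : IsProper π := hπ.isProper inferInstance
    -- `S'` as an open of `X₁`
    obtain ⟨j₁, hj₁, hj₁π, hpb₁⟩ := hπ.exists_isPullback_of_disjoint j' hT
    haveI := hj₁
    /- the new centre `W₁ = C'` (reduced: `C'` is regular), an integral regular closed
      subscheme of `X₁` lying over `W` -/
    let W₁ : Closeds X₁ := ⟨Set.range i', i'.isClosedEmbedding.isClosed_range⟩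
    let C₁ : X₁.IdealSheafData := vanishingIdeal W₁
    have hW₁W : (W₁ : Set X₁) ⊆ π ⁻¹' (W : Set X') := by
      rintro _ ⟨c, rfl⟩
      show π (i' c) ∈ (W : Set X')
      rw [← Scheme.Hom.comp_apply, hsqW, Scheme.Hom.comp_apply]
      exact mem_of_subscheme_vanishingIdeal W _
    -- `j₁⁻¹(W₁) = Y`
    have hpre : W₁.preimage j₁.continuous = Y := by
      ext s
      rw [Closeds.coe_preimage, Set.mem_preimage]
      constructor
      · intro hs
        have h1 : π (j₁ s) ∈ (W : Set X') := hW₁W hs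
        rw [← Scheme.Hom.comp_apply, hj₁π] at h1
        have h2 : s ∈ ((closureImage j' (Y : Set S')).preimage j'.continuous : Set S') := h1
        rwa [preimage_closureImage_eq] at h2
      · intro hsY
        obtain ⟨w, hw⟩ : j' s ∈ Set.range ι := by
          rw [range_subschemeι_vanishingIdeal]; exact subset_closure ⟨s, hsY, rfl⟩
        obtain ⟨c, hc⟩ := hbirW.surjective_of_universallyClosed w
        haveI : IsIso (π ∣_ j'.opensRange) :=
          hπ.isIso_morphismRestrict _ (by rw [Scheme.Hom.coe_opensRange]; exact hT)
        have h1 : π (i' c) = j' s := by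
          rw [← Scheme.Hom.comp_apply, hsqW, Scheme.Hom.comp_apply, hc, hw]
        have h2 : π (j₁ s) = j' s := by rw [← Scheme.Hom.comp_apply, hj₁π]
        refine ⟨c, injOn_preimage_of_isIso_morphismRestrict π j'.opensRange ?_ ?_
          (h1.trans h2.symm)⟩
        · show π (i' c) ∈ (j'.opensRange : Set X'); rw [h1]; exact ⟨s, rfl⟩
        · show π (j₁ s) ∈ (j'.opensRange : Set X'); rw [h2]; exact ⟨s, rfl⟩
    have hW₁ne : (W₁ : Set X₁) ≠ Set.univ := by
      intro h
      apply hYne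
      rw [← hpre, Closeds.coe_preimage, h, Set.preimage_univ]
    have hC₁ : C₁.comap j₁ = vanishingIdeal Y := by
      rw [comap_vanishingIdeal_of_isOpenImmersion, hpre]
    have hC₁0 : C₁ ≠ ⊥ := vanishingIdeal_ne_bot_of_ne_univ W₁ hW₁ne
    have hW₁irr : IsIrreducible (W₁ : Set X₁) := by
      change IsIrreducible (Set.range i')
      rw [← Set.image_univ]
      exact (IrreducibleSpace.isIrreducible_univ _).image _ i'.continuous.continuousOn
    -- the blowing up along `W₁` and its restriction over `S'`
    have hτ' : IsBlowup τ (C₁.comap j₁) := by rw [hC₁]; exact hτ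
    let j'' : S'' ⟶ blowup C₁ := (blowup.isBlowup C₁).lift (τ ≫ j₁)
      (by rw [Scheme.IdealSheafData.comap_comp]; exact hτ'.isEffectiveCartier)
    have hj''π : j'' ≫ blowup.π C₁ = τ ≫ j₁ := (blowup.isBlowup C₁).lift_comp _ _
    have hsq : IsPullback j'' τ (blowup.π C₁) j₁ :=
      (blowup.isBlowup C₁).isPullback_of_isOpenImmersion j₁ hτ' hj''π
    haveI : IsOpenImmersion j'' := MorphismProperty.of_isPullback hsq.flip inferInstance
    haveI : IsProper (blowup.π C₁) := (blowup.isBlowup C₁).isProper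
    /- isomorphism loci: all centres lie over `closure (j F)` -/
    have hcentre : (W : Set X') ⊆ ρ ⁻¹' closure (j '' (nonPrincipalLocus J : Set S)) := by
      change closure (j' '' (Y : Set S')) ⊆ _
      refine closure_minimal ?_ ((isClosed_closure).preimage ρ.continuous)
      rintro _ ⟨y, hy, rfl⟩
      have hy' : σ y ∈ (nonPrincipalLocus J : Set S) := nonPrincipalLocus_comap_subset σ J (hY y hy)
      refine subset_closure ⟨σ y, hy', ?_⟩
      rw [← Scheme.Hom.comp_apply, ← hpb.w, Scheme.Hom.comp_apply]
    haveI : IsIso (π ∣_ ρ ⁻¹ᵁ principalOpen j J) := by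
      refine hπ.isIso_morphismRestrict _ (Set.disjoint_left.mpr fun x hx hxT => ?_)
      have hxW : x ∈ (W : Set X') := by
        obtain ⟨w, -, rfl⟩ := hxT
        exact mem_of_subscheme_vanishingIdeal W w
      exact hx (hcentre hxW)
    haveI : IsIso (blowup.π C₁ ∣_ (π ≫ ρ) ⁻¹ᵁ principalOpen j J) := by
      refine (blowup.isBlowup C₁).isIso_morphismRestrict
        (Set.disjoint_left.mpr fun x hx hxC => ?_)
      rw [Scheme.IdealSheafData.coe_support_vanishingIdeal] at hxC
      have h1 : ρ (π x) ∈ closure (j '' (nonPrincipalLocus J : Set S)) := hcentre (hW₁W hxC)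
      refine (show (π ≫ ρ) x ∈ (principalOpen j J : Set X) from hx) ?_
      rw [Scheme.Hom.comp_apply]
      exact h1
    haveI : IsIso ((π ≫ ρ) ∣_ principalOpen j J) := isIso_morphismRestrict_comp _ _ _
    refine ⟨blowup C₁, blowup.π C₁ ≫ π ≫ ρ, j'', inferInstance, ?_, inferInstance,
      (blowup.isBlowup C₁).isIntegral hC₁0,
      ((blowup.isBlowup C₁).isBirational' hC₁0).comp ((hπ.isBirational inferInstance).comp hbir),
      fun k _ f hf => ?_, isIso_morphismRestrict_comp _ _ _,
      (blowup.isBlowup C₁).topologicalKrullDim_le (hπ.topologicalKrullDim_le hdim'), ?_⟩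
    · -- the cartesian square over `S`
      have := (hsq.paste_vert hpb₁).paste_vert hpb
      simpa using this
    · -- projectivity over `k`
      have := (blowup.isBlowup C₁).isProjectiveOver (π ≫ ρ ≫ f)
        (hπ.isProjectiveOver (ρ ≫ f) (hproj k f hf))
      simpa only [Category.assoc] using this
    · -- regular centres
      exact .cons (blowup.π C₁) (π ≫ ρ) W₁
        ((IsRegularCentreBlowupComposition.of_isPointBlowupComposition hπ).comp hcomp) hW₁ne
        (isIntegral_subscheme_vanishingIdeal W₁ hW₁irr)
        (isRegular_subscheme_vanishingIdeal_range i' hregC') (blowup.isBlowup C₁)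


/-! ## Prop 4.8 verbatim from principalization on the regular locus -/

section Verbatim

variable {k K : Type u} [Field k] [Field K] [Algebra k K]

open MvPolynomial HomogeneousLocalization

attribute [local instance] MvPolynomial.gradedAlgebra

/-- **Prop 4.8 with regular centres over ALL of `Z` (the printed conclusion), plus Piltant's
Axiom 4 (ii)–(iii), for a projective model `Z` of dimension `≤ 3`** from principalization on
`Z_reg` (`hPr`).  Steps (1)–(4), (6)–(8) verbatim as in
`exists_hom_forall_not_mem_fundamentalLocus_of_regPrincipalization`; step (5) now extends the
Cossart–Piltant sequence by `exists_extension_regularCentre` (devices 1- and 2- of the printed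
proof) instead of by blowing up the reduced closures of the centres directly.
[cite: CossartPiltant2008, Prop 4.8 (HAL p. 15 L20–37)]
[cite: Piltant2013, §2 Axiom 4; Prop. 5.1 (proof, Step 2)] -/
theorem exists_hom_regularCentre_forall_not_mem_fundamentalLocus_of_regPrincipalization
    (Z X : ProjModel k K) (hdim : topologicalKrullDim Z.X ≤ 3)
    (hPr : ∀ (U : Z.X.Opens), (U : Set Z.X) = Scheme.regularLocus Z.X →
      ∀ J : (U : Scheme.{u}).IdealSheafData, J ≠ ⊥ →
        ∃ (S' : Scheme.{u}) (σ : S' ⟶ U), IsRegularCentreBlowupSeq σ J ∧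
          IsLocallyPrincipal (J.comap σ)) :
    ∃ (Z' : ProjModel k K) (q : Z'.Hom Z), IsRegularCentreBlowupComposition q.f ∧ q.RegLe ∧
      (∀ V : Z.X.Opens, Disjoint (V : Set Z.X)
          (closure (fundamentalLocus Z X ∩ Scheme.regularLocus Z.X)) → IsIso (q.f ∣_ V)) ∧
      ∀ z' : Z'.X, q.f z' ∈ Scheme.regularLocus Z.X → z' ∉ fundamentalLocus Z' X := by
  classical
  /- (1) a projective embedding `ι₁ : X ↪ ℙⁿ_k` and homogeneous coordinates `w ∈ Kⁿ⁺¹` of the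
    generic point of `X` -/
  obtain ⟨n, ι₁', hι₁'⟩ := X.isProjectiveOver
  let ι₁ : X.X ⟶ Proj (Segre.grading (Fin (n + 1)) k) := ι₁'.left
  haveI : IsClosedImmersion ι₁ := hι₁'
  have hι₁w : ι₁ ≫ Segre.toSpec (Fin (n + 1)) k = X.π := Over.w ι₁'
  let P₁ : AlgPoints (projectiveSpace n k) K := ProjModel.genOver X ≫ ι₁'
  obtain ⟨w, hw, hPw⟩ := ProjectiveSpace.exists_eq_pointOfVec (k := k) (L := K) P₁
  have hPw_left : X.gen ≫ ι₁ = (ProjectiveSpace.pointOfVec k w hw).left := by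
    rw [← hPw]; rfl
  /- (2) the rational map `Z ⋯→ X ⊆ ℙⁿ_k` in coordinates -/
  let z : Fin (n + 1) → Z.X.functionField := fun l => Z.funFieldAlgEquiv.symm (w l)
  have hz : z ≠ 0 := ProjectiveSpace.algHom_comp_ne_zero Z.funFieldAlgEquiv.symm.toAlgHom hw
  have hz' : ∃ i, z i ≠ 0 := by
    by_contra h
    push Not at h
    exact hz (funext h)
  /- (3) the regular locus `U` of `Z` (a regular integral open subscheme) -/
  have hqe : Scheme.IsQuasiExcellent Z.X :=
    (Scheme.isExcellent_of_locallyOfFiniteType Stacks07QW_field_holds Z.π).isQuasiExcellent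
  obtain ⟨U, hU⟩ := Scheme.exists_opens_coe_eq_regularLocus hqe
  have hUne : (U : Set Z.X).Nonempty := by
    rw [hU]; exact (Scheme.dense_regularLocus Z.X).nonempty
  haveI : Nonempty (U : Scheme.{u}) := hUne.to_subtype
  haveI hintU : IsIntegral (U : Scheme.{u}) := isIntegral_of_isOpenImmersion U.ι
  have hregU : Scheme.IsRegular (U : Scheme.{u}) := fun x => by
    have hx : (U.ι x) ∈ Scheme.regularLocus Z.X := by
      rw [← hU, Scheme.Opens.ι_apply]; exact x.2
    haveI : IsRegularLocalRing (Z.X.presheaf.stalk (U.ι x)) := hx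
    exact IsRegularLocalRing.of_ringEquiv (asIso (U.ι.stalkMap x)).commRingCatIsoToRingEquiv
  /- (4) the base ideal of the rational map, restricted to `U`, is non-zero -/
  let J : (U : Scheme.{u}).IdealSheafData := (baseIdeal z).comap U.ι
  have hJ : J ≠ ⊥ := by
    intro hbot
    let y : (U : Scheme.{u}) := Classical.arbitrary _
    have h1 : stalkIdeal J y = ⊥ := by rw [hbot, stalkIdeal_bot]
    rw [stalkIdeal_comap_of_isOpenImmersion] at h1
    obtain ⟨b, hb, hb0⟩ :=
      (Submodule.ne_bot_iff _).mp (stalkIdeal_baseIdeal_ne_bot hz' (U.ι y))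
    apply hb0
    have hb' : (U.ι.stalkMap y).hom b ∈
        (stalkIdeal (baseIdeal z) (U.ι y)).map (U.ι.stalkMap y).hom :=
      Ideal.mem_map_of_mem _ hb
    rw [h1, Ideal.mem_bot] at hb'
    exact (asIso (U.ι.stalkMap y)).commRingCatIsoToRingEquiv.injective
      (hb'.trans (map_zero _).symm)
  /- (5) principalize on `U` and extend to `Z` BY BLOWING UPS WITH REGULAR CENTRES
    (devices 1-, 2-), with the iso locus -/
  obtain ⟨S', σ, hσ, hprinc⟩ := hPr U hU J hJ
  obtain ⟨X', ρ, j', hj', hpb, hprop, hint', hbir, hproj, hisoP, -, hcomp⟩ :=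
    exists_extension_regularCentre hσ hintU inferInstance hJ hregU hqe hdim U.ι
  haveI := hj'
  haveI := hint'
  haveI := hprop
  haveI := hisoP
  haveI : IsLocallyNoetherian X' := LocallyOfFiniteType.isLocallyNoetherian ρ
  haveI : IsIntegral S' := hσ.isIntegral hJ
  have hregS' : Scheme.IsRegular S' := hσ.isRegular hregU
  have hover : ∀ x' : X', ρ x' ∈ Set.range U.ι → ∃ s' : S', j' s' = x' := by
    rintro x' ⟨s, hs⟩
    obtain ⟨s', hs'₁, -⟩ := Scheme.Pullback.exists_preimage_pullback x' s hs.symm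
    refine ⟨(hpb.isoPullback).inv s', ?_⟩
    rw [← hs'₁, ← Scheme.Hom.comp_apply, IsPullback.isoPullback_inv_fst]
  /- (6) `X'` as a projective model `Z'` dominating `Z`, regular over `U` -/
  have hproj₂ : Motives.IsProjectiveOver (Over.mk (ρ ≫ Z.π) : SchemeOver k) :=
    hproj k Z.π Z.isProjectiveOver
  obtain ⟨U₀, hU₀, hiso⟩ := Z.exists_nonempty_isIso_morphismRestrict hbir
  haveI := hiso
  let Z' : ProjModel k K := ProjModel.ofModification Z ρ U₀ hU₀ hproj₂
  let q : Z'.Hom Z := ProjModel.ofModificationHom Z ρ U₀ hU₀ hproj₂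
  have hqf : q.f = ρ := rfl
  have hregX' : ∀ y : X', ρ y ∈ (U : Set Z.X) → IsRegularLocalRing (X'.presheaf.stalk y) := by
    intro y hy
    obtain ⟨s', rfl⟩ := hover y (by rwa [Scheme.Opens.range_ι])
    haveI := hregS' s'
    exact IsRegularLocalRing.of_ringEquiv (asIso (j'.stalkMap s')).commRingCatIsoToRingEquiv.symm
  /- (7) the transported rational map `z'` on `X'` is defined over `j'(S') = ρ⁻¹(U)` -/
  haveI : IsDominant ρ := q.isDominant
  let z' : Fin (n + 1) → X'.functionField := fun l => RatFn.functionFieldMap ρ (z l)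
  have hz'eq : z' = fun l => Z'.funFieldAlgEquiv.symm (w l) :=
    funext fun l => ProjModel.functionFieldMap_funFieldIso_inv q (w l)
  have hdef' : ∀ s' : S', IsDefinedAt z' (j' s') := by
    intro s'
    refine isDefinedAt_of_isLocallyPrincipalAt_comap ρ hz'
      (isLocallyPrincipalAt_of_comap_isOpenImmersion j' _ ?_)
    have h := hprinc s'
    have hJσ : J.comap σ = ((baseIdeal z).comap ρ).comap j' := by
      change ((baseIdeal z).comap U.ι).comap σ = _
      rw [← Scheme.IdealSheafData.comap_comp, ← Scheme.IdealSheafData.comap_comp, hpb.w]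
    rwa [hJσ] at h
  /- (8) the closure of the regular fundamental locus is the closure of `U.ι(F_J)`, `F_J` the
    non-locally-principal locus of `J` -/
  have hFz : fundamentalLocus Z X = {m | ¬ IsDefinedAt z m} :=
    fundamentalLocus_eq_setOf_not_isDefinedAt Z X ι₁ hι₁w w hw hPw_left
  have hF : U.ι '' (nonPrincipalLocus J : Set U) = fundamentalLocus Z X ∩
      Scheme.regularLocus Z.X := by
    rw [hFz]
    ext m
    constructor
    · rintro ⟨u, hu, rfl⟩
      refine ⟨fun hdef => hu ((isLocallyPrincipalAt_baseIdeal hdef).comap U.ι), ?_⟩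
      rw [← hU]; exact u.2
    · rintro ⟨hm, hmreg⟩
      rw [← hU] at hmreg
      refine ⟨⟨m, hmreg⟩, fun hu => hm ?_, rfl⟩
      exact (isDefinedAt_iff_isLocallyPrincipalAt (z := z) hz').mpr
        (isLocallyPrincipalAt_of_comap_isOpenImmersion U.ι _ hu)
  refine ⟨Z', q, hcomp, fun y hy => ?_, fun V hV => ?_, fun y hy hyF => hyF ?_⟩
  /- (ii) regularity over `U` -/
  · rw [hqf] at hy
    exact hregX' y (by rw [hU]; exact hy)
  /- (iii) `q = ρ` is an isomorphism over every open missing the closure of `U.ι(F_J)` -/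
  · have hVP : V ≤ principalOpen U.ι J := by
      intro m hm hmem
      rw [coe_closureImage, hF] at hmem
      exact Set.disjoint_left.mp hV hm hmem
    rw [hqf]
    exact isIso_morphismRestrict_of_le ρ hisoP hVP
  /- no fundamental point over `U` -/
  · rw [hqf] at hy
    have hyU : ρ y ∈ (U : Set Z.X) := by rw [hU]; exact hy
    obtain ⟨s', hs'⟩ := hover y (by rwa [Scheme.Opens.range_ι])
    have hdef : IsDefinedAt (fun l => Z'.funFieldAlgEquiv.symm (w l)) y := by
      rw [← hz'eq, ← hs']
      exact hdef' s'
    exact (ProjModel.hasCentre_stalkSubring_iff_isDefinedAt Z' X ι₁ hι₁w w hw hPw_left y).mpr hdef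

/-- **[CP-I] Proposition 4.8 verbatim — elimination of regular fundamental points by blowing
ups with regular centres, for function fields of transcendence degree three — from the
principalization theorem [CP-I] Prop. 4.2 (`CossartPiltant2019Principalization`).**  This
discharges the named fact `EliminationOfRegularFundamentalPoints` of
`Prop48FundamentalLocus2008.lean` modulo the principalization fact, closing the DEVIATION
recorded there. [cite: CossartPiltant2008, Prop 4.8 (HAL p. 15 L20–37)] -/
theorem eliminationOfRegularFundamentalPoints_of_principalization
    (hP : CossartPiltant2019Principalization.{u}) : EliminationOfRegularFundamentalPoints.{u} := by
  intro k K _ _ _ htr Z X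
  have hdim : topologicalKrullDim Z.X = 3 := by rw [Z.topologicalKrullDim_eq_of_trdeg htr]; rfl
  obtain ⟨Z', q, hcomp, -, -, hF⟩ :=
    exists_hom_regularCentre_forall_not_mem_fundamentalLocus_of_regPrincipalization Z X hdim.le
      (ProjModel.regPrincipalization_of_principalization hP Z hdim)
  exact ⟨Z', q, hcomp, fun z' hz' => hF z' hz'.2⟩

/-- **Prop 4.8 verbatim together with Piltant's Axiom 4 (ii)–(iii)** (regularity over `Z_reg`,
isomorphism off the closure of `F ∩ Z_reg`), transcendence degree three.
[cite: CossartPiltant2008, Prop 4.8 (HAL p. 15)] [cite: Piltant2013, §2 Axiom 4] -/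
theorem exists_hom_regularCentre_forall_not_mem_fundamentalLocus_of_trdeg
    (hP : CossartPiltant2019Principalization.{u}) (htr : Algebra.trdeg k K = 3)
    (Z X : ProjModel k K) :
    ∃ (Z' : ProjModel k K) (q : Z'.Hom Z), IsRegularCentreBlowupComposition q.f ∧ q.RegLe ∧
      (∀ V : Z.X.Opens, Disjoint (V : Set Z.X)
          (closure (fundamentalLocus Z X ∩ Scheme.regularLocus Z.X)) → IsIso (q.f ∣_ V)) ∧
      ∀ z' : Z'.X, q.f z' ∈ Scheme.regularLocus Z.X → z' ∉ fundamentalLocus Z' X := by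
  have hdim : topologicalKrullDim Z.X = 3 := by rw [Z.topologicalKrullDim_eq_of_trdeg htr]; rfl
  exact exists_hom_regularCentre_forall_not_mem_fundamentalLocus_of_regPrincipalization Z X
    hdim.le (ProjModel.regPrincipalization_of_principalization hP Z hdim)

/-- Hence the printed reduction of Prop 4.9 needs only [12] and the principalization theorem:
`RefinedPatchingOfProps47And48 → CossartPiltant2019Principalization → RefinedPatching`
(Prop 4.7 is the theorem `AbhyankarQuadraticFactorization_holds`).
[cite: CossartPiltant2008, p. 15 lines 39–42] -/
theorem refinedPatching_of_props47And48_of_principalization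
    (h12 : RefinedPatchingOfProps47And48.{u}) (hP : CossartPiltant2019Principalization.{u}) :
    RefinedPatching.{u} :=
  refinedPatching_of_props47And48 h12 (eliminationOfRegularFundamentalPoints_of_principalization hP)

end Verbatim

end Literature.AlgebraicGeometry.CossartPiltant200819.CP2008

end
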